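/-
COR-CM (cell pub-hodgecm2, stage 2 of the Hodge ladder) — Δ2 BRIDGE, ι₁∕Id CHAIN (ASSEMBLER MODULE TABLE v1.1, HOME/d2bridge/iota1/TABLE.md;
coordinator ruling «WORLD = C FINAL», pub-hodgecm2/INBOX l.12654): prove-8's engine ✔ `HcmPiecesAtTower.nonempty_hcmPieces_ofTower`
(p369968) RE-TYPED ONCE over an ARBITRARY Prop-C.5 datum `P5` and an ARBITRARY level subgroup `KK ≤ C.G`, so that the SAME theorem serves the
twisted datum of record (`Model.honestP5Of h …`, `KK := K.K`) and the untwisted datum of the Id chain (`Model.honestP5IdOf h …`, `KK := K.K`)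
without a twin.  Seat prover-pub-hodgecm2-d2bridge-wb-3-g4-0 (WALL-BREAKER 3 ∕ «b» of table rows I7 ∕ I10).  THEOREMS ONLY (kernel lane):
no definition, no named fact, no instance, no section `variable` carrying a named Prop, no `sorry`; nothing landed is edited or restated
(the landed engine is the `P5 := honestP5Of h …`, `KK := K.K` instance of this one, token for token); OUTSIDE the frozen port manifest.
FRAMING: HC_CM is NOT proved; «Δ2 BRIDGE CLOSED» is NOT claimed; hLiu = READING r8; HELD.
-/
import Summits.HodgeConjecture.CorCM.D2Bridge.HcmPieces
import Summits.HodgeConjecture.CorCM.D2Bridge.OmegaLevelwisePullback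
import Summits.HodgeConjecture.CorCM.D2Bridge.HcmS4Functoriality
import Summits.HodgeConjecture.HodgeCM.Model.LiuDictionaryTower
import HarnessLib

/-!
# Δ2 bridge, pin (d): the pieces `HcmPieces` at the tower dictionary — the engine over ANY Prop-C.5 datum

[Liu2021] Y. Liu, *Fourier–Jacobi cycles and arithmetic relative trace formula*, Camb. J. Math. **9** (2021) 1–147 =
arXiv:2102.11518; `l. NNNN` = lines of the author's TeX `FJcycle.tex`.

## What this file is

✔ `nonempty_hcmPieces_ofTower` (`CorCM/D2Bridge/HcmPiecesAtTower.lean`, d2bridge-prove-8) builds, from the named junction inputs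
`rj ∕ hj` (S3), `jf ∕ hrj` (S4), `dLiu ∕ u ∕ hu ∕ hadm` (S1) and prove-2's S2 (`map42_P_eq`), the one inhabitant of
`HcmPieces (toThm418Data C (restOne …)) M T.H jH K.K (H¹(P_K; ℂ)) (resTotal … K) (T.cmClasses K i)` that the resolved Δ2 increment asks
for — but its standing datum is typed `C : Sec42Data (Model.honestP5Of h ⟨L.K⟩ ι₁ ⟨V.Hm, …⟩ Φ) isotropicAt`, i.e. over the App.-C
datum TWISTED by the complex conjugation of `L` (`X_K := M_K ⊗_{L,c} L`), for the single purpose of having `C.G = U(V)(𝔸_{L⁺,f})`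
ON THE NOSE so that the model level's compact open `K.K` is a subgroup of `C.G`.  Under the coordinator's ruling «WORLD = C» the
(c)+(d) residual closes by value only over the UNTWISTED datum (`Model.honestP5IdOf h`, Id chain), whose `G` field is the same
`U(V)(𝔸_{L⁺,f})`.  Reading the engine's proof shows that NOTHING in it relates `K.K` to `K` except through the junction hypotheses:
so THIS FILE states it once for

* ANY Prop-C.5 datum `P5 : PropC5Data L⁺ L` and ANY §4.2 datum `C : Sec42Data P5 isotropicAt` over it ([Liu2021] §4.2, App. C Prop. C.5),
* ANY subgroup `KK ≤ C.G` indexing the group `Hom_E(A_{KK}, A_μ)_ℚ` of Thm. 4.18 (1) (App. C's level `C.levelOf KK`), and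
* ANY model level `K : Level V` carrying the target `H¹(P_K; ℂ)`, the restriction `resTotal … K` and the generators `T.cmClasses K i`,

with the junction inputs typed accordingly (`rj : Λ.AKQ (C.levelOf KK) →ₗ[ℚ] H¹(P_K; ℚ)`, `jf f : P_K ⟶ A_μ ⊗ ℂ` for `f : A_{levelOf KK} → A_μ`):
`nonempty_hcmPieces_ofTower_anyDatum`.  The proof is prove-8's, token for token.  Instances: the landed engine is
`P5 := Model.honestP5Of h …`, `KK := K.K`; the Id chain's engine (table rows I7 ∕ I8) is `P5 := Model.honestP5IdOf h …`, `KK := K.K` —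
both by application, no further file.  Nothing about Liu's objects is asserted: every input is a named binder discharged by its owner's
pin file.  HC_CM is NOT proved; «Δ2 BRIDGE CLOSED» is NOT claimed.

## References
* [Liu2021] Y. Liu, arXiv:2102.11518 = Camb. J. Math. 9 (2021): Thm. 4.18 (l. 2232–2245) with proof, map (4.2)/(4.3) (l. 2247–2253);
  Thm. 4.18 (1) (l. 2239); Rem. 4.17 (l. 2226–2228); Lem. 2.4 (1) with proof (l. 1210–1228); Def. 2.3; Def. 4.5 (2) (l. 1944–1951);
  §4.2 l. 2062–2081 (`A_K = Alb_{X_K}`, `A_∞`, `H¹_{B,τ'}(A_∞, ℂ)`); App. C Prop. C.5 (l. 4627–4633).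
-/

set_option autoImplicit false

noncomputable section

open scoped TensorProduct

namespace Summit.HodgeConjecture.CorCM.D2Bridge

open CategoryTheory NumberField
open Literature.AlgebraicGeometry.Motives (SchemeOver AbelianVariety bettiCohomology)
open Literature.AlgebraicGeometry.HodgeTheory
open Literature.AlgebraicGeometry.HodgeTheory.BettiUniverse (pull)
open Literature.AlgebraicGeometry.ShimuraVarieties.UnitaryCanonicalModel
open Literature.NumberTheory.Automorphic Literature.NumberTheory.Automorphic.PicardCM
open Literature.NumberTheory.Automorphic.Liu2021 Literature.NumberTheory.Automorphic.Liu2021.AppendixC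
open Literature.NumberTheory.Automorphic.Liu2021.AppendixC.RestOne
open Literature.NumberTheory.Transcendental (Arapura2012_Cor_15_4_6)
open HodgeCM.Model HodgeCM.Model.TowerCarrier
open HodgeCM.Literature.Theta.LiuAlbaneseModuleDatum.D2Bridge (HcmPieces)

section PiecesAtTowerAnyDatum

variable {hHD : exists_isReal_hodgeModel} {hI : hodgePQ_independent_of_hodgeModel}
  {h₁ : BallQuotientUniformised} {h₃ : CMAbelianVarietyRealised} {hA : Arapura2012_Cor_15_4_6}
variable {L : HodgeCM.CMField} {ι₁ : (L : Type) →+* ℂ} (V : HodgeCM.HermSpace3 L ι₁)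
-- the tower dictionary's remaining parameters (DECISION #8: `Ω i a := (line i).Ω ιV (χof i a)`; any family here)
variable (Char : Type) (Adm : Char → Type) (Ω : (i : Char) → Adm i → Type)
  [∀ i a, AddCommGroup (Ω i a)] [∀ i a, Module ℂ (Ω i a)] [∀ i a, Module (adelicAlgebra V) (Ω i a)]
  [∀ i a, IsScalarTower ℂ (adelicAlgebra V) (Ω i a)] (PhiMu : Char → Prop) (adm : Char → LiuCMSide → Prop)
-- ANY Prop-C.5 datum over `L ∕ L⁺` and ANY §4.2 datum over it (the twisted `honestP5Of h …` and the untwisted `honestP5IdOf h …` alike)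
variable {P5 : PropC5Data (maximalRealSubfield (L : Type)) (L : Type)} {isotropicAt : ℕ → Prop} (C : Sec42Data P5 isotropicAt)
-- the one-object rest: `D_μ`, `A_μ`, `Ω(μ)`, `res` REAL; the Weil side and `rhoΩ` FREE (δ′-agnostic)
variable [Algebra (L : Type) ℂ]
  {Lg : Type} [Field Lg] [NumberField Lg] [IsGalois ℚ Lg] (emb : (L : Type) →ₐ[ℚ] Lg) (ιg : Lg →+* ℂ)
  {μ : Literature.NumberTheory.Automorphic.IdeleClassGroup (L : Type) →ₜ* Circle} (hμ : Literature.NumberTheory.Automorphic.IdeleClassGroup.IsConjugateSymplectic (L : Type) μ)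
  (hw : Literature.NumberTheory.Automorphic.IdeleClassGroup.HasWeight (L : Type) μ 1) (Car : Def45.Carriers (L : Type) μ)
  (Eps : Type) (epsOf : L → Eps) (Chi : Type) (omega : Eps → Chi → Type)
  [∀ ε χ, AddCommGroup (omega ε χ)] [∀ ε χ, Module ℂ (omega ε χ)]
  (rho : ∀ ε χ, Representation ℂ C.G (omega ε χ))
  (rhoΩ : Representation (fieldOfValues (L : Type) μ) C.G (ΩOne C emb ιg hμ hw Car))

/-- **Δ2 BRIDGE, PIN (d): THE PIECES `HcmPieces` AT THE TOWER DICTIONARY over ANY Prop-C.5 datum, from the named junction inputs.**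
For every §4.2 datum `C` over any Prop-C.5 datum `P5` of `L ∕ L⁺` ([Liu2021] §4.2 l. 2062–2081, App. C Prop. C.5), every record `M` of the
proof's objects over the one-object rest whose pull-back is the constructed (4.2) (`hMP`), every reading `jH` of its complex carrier into
the tower, every subgroup `KK ≤ C.G` (indexing `Hom_E(A_{KK}, A_μ)_ℚ`, Thm. 4.18 (1) l. 2239), every model level `K`, and the junction inputs
`rj ∕ hj` (S3: tower bookkeeping + Lem. 2.4 (1) at the identity component), `jf ∕ hrj` (S4: functoriality of `f ↦ f^*`, proof of Thm. 4.18
l. 2247–2253), `dLiu ∕ u ∕ hu ∕ hadm` (S1: Liu's own CM datum, Def. 4.5 (2), as an admissible model record with its transported eigenclass),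
the structure `HcmPieces (toThm418Data C (restOne …)) M T.H jH KK (H¹(P_K; ℂ)) (resTotal … K) (T.cmClasses K i)` at
`T := LiuDictionary.ofTower hHD hI h₁ h₃ hA V Char Adm Ω PhiMu adm` is INHABITED — fields exactly as in prove-8's ✔ `nonempty_hcmPieces_ofTower`
(`AK := XK := ℂ ⊗ Λ.AKQ (C.levelOf KK)`, `phiStar φ := (Λ.phiStarQHom _ φ) ⊗ ℂ`, `transK := M.ι ∘ (Λ.transKQ _ ⊗ ℂ)`, `P_eq := map42_P_eq` (S2),
`albK := refl`, `resX := rj ⊗ ℂ`, `tower_eq := hj` (S3), `CM := LiuCMSide`, `geom := geomClass K`, `geom_mem := geomClass_mem_cmClasses`,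
`admLiu := hadm` (S1), `qOf φ ⊗ f_φ = φ` (✔ `exists_eq_rat_tmul`), `f_of φ := jf f_φ ≫ u (qOf φ)`, `geom_eq := hrj + hu` (S4)), whose
proof this is, token for token; the landed engine is the instance `P5 := Model.honestP5Of h …`, `KK := K.K`, and the Id chain's engine
the instance `P5 := Model.honestP5IdOf h …`, `KK := K.K`.  HC_CM is NOT proved; «Δ2 BRIDGE CLOSED» is NOT claimed; nothing here is a display
or a pointer move.
[cite: Liu2021, Thm. 4.18 (1) (FJcycle.tex l. 2239), Rem. 4.17 (l. 2226–2228), proof of Thm. 4.18 map (4.2)/(4.3) (l. 2247–2253), Lem. 2.4 (1) (l. 1210–1228), Def. 4.5 (2) (l. 1944–1951), App. C Prop. C.5 (l. 4627–4633)] -/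
theorem nonempty_hcmPieces_ofTower_anyDatum
    (M : (toThm418Data C (restOne C emb ιg hμ hw Car Eps epsOf Chi omega rho rhoΩ)).Map43RationalData)
    (Λ : LevelwiseBettiPullback C (AμOne emb ιg hμ hw Car M.Dμ) M.L M.U)
    (hMP : M.P = PΩOne C emb ιg hμ hw Car M.Dμ Λ)
    (jH : M.HB →ₗ[ℂ] (LiuDictionary.ofTower hHD hI h₁ h₃ hA V Char Adm Ω PhiMu adm).H)
    (i : Char) (KK : Subgroup C.G) (K : HodgeCM.Level V)
    -- ── S3 junction: the level-`KK` tower map read on `P_K` by `res ∘ jH ∘ ι` IS the complexified `ℚ`-linear `rj` ──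
    (rj : Λ.AKQ (C.levelOf KK) →ₗ[ℚ]
      (picardCMUniverse hHD hI h₁ h₃).Coh ((picardCMUniverse hHD hI h₁ h₃).pms L ι₁ V K) 1)
    (hj : ∀ (z : ℂ) (x : Λ.AKQ (C.levelOf KK)),
      resTotal hHD hI (ballQuotientUniformisedDatum_of h₁) h₃ hA K
          (jH (M.ι ((Λ.transKQ (C.levelOf KK)).baseChange ℂ (z ⊗ₜ[ℚ] x)))) = z ⊗ₜ[ℚ] rj x)
    -- ── S4 junction: `rj ∘ f^*` on the eigenclass is ONE complexified pull-back along `jf f : P_K ⟶ A_μ ⊗ ℂ` ──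
    (α₀ : ℂ ⊗[ℚ] bettiCohomology ((AμOne emb ιg hμ hw Car M.Dμ).baseChange ℂ).X 1)
    (jf : (C.A (C.levelOf KK) ⟶ AμOne emb ιg hμ hw Car M.Dμ) →
      ((pmsRealisation (ballQuotientUniformisedDatum_of h₁) (pmsCode L ι₁ V K)).X ⟶
        ((AμOne emb ιg hμ hw Car M.Dμ).baseChange ℂ).X))
    (hrj : ∀ f : C.A (C.levelOf KK) ⟶ AμOne emb ιg hμ hw Car M.Dμ,
      (rj ∘ₗ Λ.phiStarQ (C.levelOf KK) f).baseChange ℂ M.α = (pull (jf f) 1).baseChange ℂ α₀)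
    -- ── S1 junction: Liu's own CM datum as a `ℚ`-family of model records, eigenclass transported along `u`, admissible at `i` ──
    (dLiu : ℚ → LiuCMSide)
    (u : ∀ q : ℚ, ((AμOne emb ιg hμ hw Car M.Dμ).baseChange ℂ).X ⟶ (dLiu q).A.X)
    (hu : ∀ (q : ℚ) (Y : SchemeOver ℂ) (f : Y ⟶ ((AμOne emb ιg hμ hw Car M.Dμ).baseChange ℂ).X),
      (pull (f ≫ u q) 1).baseChange ℂ (dLiu q).α = (q : ℂ) • (pull f 1).baseChange ℂ α₀)
    (hadm : ∀ q : ℚ, adm i (dLiu q)) :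
    Nonempty (HcmPieces.{0, 1, 0} (toThm418Data C (restOne C emb ιg hμ hw Car Eps epsOf Chi omega rho rhoΩ)) M
      (LiuDictionary.ofTower hHD hI h₁ h₃ hA V Char Adm Ω PhiMu adm).H jH KK
      ((picardCMUniverse hHD hI h₁ h₃).CohC ((picardCMUniverse hHD hI h₁ h₃).pms L ι₁ V K) 1)
      (resTotal hHD hI (ballQuotientUniformisedDatum_of h₁) h₃ hA K)
      ((LiuDictionary.ofTower hHD hI h₁ h₃ hA V Char Adm Ω PhiMu adm).cmClasses K i)) := by
  classical
  -- S3: the junction law on pure tensors IS the equality of the two `ℂ`-linear maps `ℂ ⊗_ℚ AKQ → H¹(P_K; ℂ)`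
  have hj' : resTotal hHD hI (ballQuotientUniformisedDatum_of h₁) h₃ hA K ∘ₗ jH ∘ₗ M.ι ∘ₗ
      (Λ.transKQ (C.levelOf KK)).baseChange ℂ = rj.baseChange ℂ :=
    TensorProduct.AlgebraTensorModule.ext fun z x => (hj z x).trans (LinearMap.baseChange_tmul rj z x).symm
  -- S4: every `φ ∈ ℚ ⊗_ℤ Hom_E(A_{KK}, A_μ)` is `q_φ ⊗ f_φ` (✔ `exists_eq_rat_tmul`)
  choose qOf fOf hrepr using fun φ : C.HomQ (C.levelOf KK) (AμOne emb ιg hμ hw Car M.Dμ) => exists_eq_rat_tmul φ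
  refine ⟨{
    -- ── S2 (prove-2, ✔ `map42_P_eq`) ──
    AK := ℂ ⊗[ℚ] Λ.AKQ (C.levelOf KK)
    phiStar := fun φ => (Λ.phiStarQHom (C.levelOf KK) φ).baseChange ℂ
    transK := M.ι ∘ₗ (Λ.transKQ (C.levelOf KK)).baseChange ℂ
    P_eq := fun φ => map42_P_eq C emb ιg hμ hw Car Eps epsOf Chi omega rho rhoΩ M Λ hMP KK φ
    -- ── S3 (tower bookkeeping; the junction `hj`) ──
    XK := ℂ ⊗[ℚ] Λ.AKQ (C.levelOf KK)
    albK := LinearEquiv.refl ℂ _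
    resX := rj.baseChange ℂ
    tower_eq := fun c => LinearMap.congr_fun hj' c
    -- ── S1 (the dictionary's comprehension `cmClasses`; Liu's own datum admissible) ──
    CM := LiuCMSide
    adm := adm i
    Mor := fun d => (pmsRealisation (ballQuotientUniformisedDatum_of h₁) (pmsCode L ι₁ V K)).X ⟶ d.A.X
    geom := fun d f => LiuDictionary.geomClass (hHD := hHD) (hI := hI) (h₃ := h₃) K d f
    geom_mem := fun d hd f =>
      (LiuDictionary.ofTower hHD hI h₁ h₃ hA V Char Adm Ω PhiMu adm).geomClass_mem_cmClasses hd f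
    dLiu := dLiu
    admLiu := hadm
    -- ── S4 (functoriality; the junction `hrj` and the transport `hu`) ──
    qOf := fun φ => qOf φ
    f_of := fun φ => jf (fOf φ) ≫ u (qOf φ)
    geom_eq := fun φ => ?_ }⟩
  -- `resX (albK (phiStar φ α)) = geom (dLiu q_φ) (jf f_φ ≫ u q_φ)`: the level map at `φ = q_φ ⊗ f_φ` is `q_φ • f_φ^*`
  have hφ : Λ.phiStarQHom (C.levelOf KK) φ = qOf φ • Λ.phiStarQ (C.levelOf KK) (fOf φ) :=
    (congrArg (Λ.phiStarQHom (C.levelOf KK)) (hrepr φ)).trans (Λ.phiStarQHom_tmul _ _ _)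
  show (rj.baseChange ℂ ∘ₗ (Λ.phiStarQHom (C.levelOf KK) φ).baseChange ℂ) M.α =
    (pull (jf (fOf φ) ≫ u (qOf φ)) 1).baseChange ℂ (dLiu (qOf φ)).α
  rw [← LinearMap.baseChange_comp, hφ, LinearMap.comp_smul, LinearMap.baseChange_smul, LinearMap.smul_apply, hrj, hu]
  -- `q • v = (q : ℂ) • v` (the two `ℚ`-actions on `ℂ ⊗_ℚ H¹(P_K; ℚ)` agree definitionally, not syntactically: close by `exact`)
  exact (ratCast_smul_eq_rat_smul (qOf φ) _).symm

end PiecesAtTowerAnyDatum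

end Summit.HodgeConjecture.CorCM.D2Bridge

end
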